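/-
Copyright (c) 2026 the pub-hodgecm-mathlib formalisation cell (harness21).  Prover seat hodgecm-mathlib-K2Liu-p09 (g9), Track B «K2-LIT» ∕ hLiu418
#184♮, #42S BLOCK D row D-2, (σ-A) mini-road brick [A1] «corner action words» (LEAD F0P6-plan (g15) RULING M-160f ∕ BATCH #227 (ii); road desk K2Liu-p25 (g3)
WORD #1), 2026-09-05.  THEOREMS ONLY.
-/
import Summits.HodgeConjecture.HodgeConjecture.Theorems.K2LiuTensorMiddleCellHaarDelta    -- ★ (M2a-C2a): `exists_ne_zero_swSectionTensorLoc_flip_mul_nElem_eq_integral`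
import Summits.HodgeConjecture.HodgeConjecture.Theorems.K2LiuBadPlaceWhittakerShells      -- ★ `nElem_conj_eq` (`n(A t D⁻¹) = q n(t) q⁻¹` for `q ∈ P_Δ(L⁺_v)`)
import HarnessLib

/-!
# Crux `HLiu418`, #42S block D row D-2, (σ-A) brick [A1]: THE y-STAGE CORNER WORD OF THE LOCAL SIEGEL–WEIL SECTION ON THE TENSOR DATUM —
# `F_Φ(w₁ · m · n(t) · g) = c · ∫_{X₁} (unipOpPi c_{t′} (op(j̃(p₁,p₂)) (frameOp_{PD}⁻¹ (ω(s′((m·g) ⊗ 1)) Φ))))(x₁ ⊔ 0) dx₁`, ONE `c ≠ 0`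

Cell `hodgecm-mathlib`, crux item hLiu418 = `stmt-HodgeConjecture-24832`; squad K2 ∕ K2Liu; helper lane `--supports stmt-HodgeConjecture-24832 --as helper`,
count-neutral.  THEOREMS ONLY (no `def`, no `instance`, no `notation`, no named-fact hypothesis, no `sorry`).

WHY.  The (σ-A) mini-road (K2Liu-p25 (g3) census 2026-09-05T01:17:33Z; RULING M-160f) computes the stage-B corner value of the K1a place letters ★
`K2LiuRankOneStagePlaceLetterValues.chainValues_of_placeLetter` — `f ½ (φ(w₂) · φ(u_{2e₂}(yδ)) · g)`, `φ X = frameConj … Q hQ (toLocalFour … X)` — for the local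
Siegel–Weil section of the BIG pair `U(2,2) × U(V′)` on the tensor datum (★ D-A `swSectionTensorLoc`).  Brick [A1-mat] (F0P2-p10 (g3) SIG 01:27:19Z, pen F0P2-p07 (g2))
reads the corner elements through their Δ-adapted matrices: `φ(u_{2e₂}(yδ)) = n(t_y)` (a Siegel unipotent) and `φ(w₂) = w₁ · m` with `w₁` a FLIP of the corner line
(adapted matrix `[[1 − P, P], [P, 1 − P]]`, ★ `K2LiuLocalSWFlipElements`) and `m ∈ P_Δ(L⁺_v)` a Siegel(-Levi) element.  The y-stage word is therefore the value of
`F_Φ` at `w₁ · m · n(t) · g`; the tensor datum's middle-cell word at `w₁ · n(t)` is ★ (M2a-C2a) `K2LiuTensorMiddleCellHaarDelta` (K2Liu-p01 lineage; (M1) ★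
`K2LiuLocalSWTensorMiddleCellTransport` ∘ (M2a-C1) ★ `K2LiuBlockMiddleCellHaarDelta`).  THIS FILE inserts the Siegel element and the right factor:
* **`exists_ne_zero_swSectionTensorLoc_flip_siegel_nElem_mul_eq_integral`** — with ★ (M2a-C2a)'s data VERBATIM (lines `i₀ ≠ i₁`, permutation frame `σ, P, PD`,
  `Pᵀ · gramR(𝕍 ⊗ V′) · P = T₁ ⊕ᶠ T₂ = diagonal t′`, the flip `w₁` by its adapted matrix, the block data `p₁ hW₁ p₂`, conductor exponent `m`, ANY outer
  mover-implementer `m₀`) and a Siegel element `m` (`blkC (matA m) = 0`): ONE `c ≠ 0` with, for every skew `t`, every block-side skew `t′` reading the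
  `m`-CONJUGATE `A t D⁻¹` (`A = blkA (matA m)`, `D = blkD (matA m)`; ★ `K2LiuTensorMiddleCellSiegelLetters.exists_blockSkew` supplies it), every `g` and `Φ`:
  `F_Φ(w₁ · m · n(t) · g) = c · ∫_{X₁} (unipOpPi c_{t′} (op(j̃(p₁,p₂)) (frameOp_{PD}⁻¹ (ω(s′(tensorEmbLoc (m · g))) Φ))))(x₁ ⊔ 0) dμ^{⊗(M₂+M₂)}` —
  `w₁ · m · n(t) · g = (w₁ · n(A t D⁻¹)) · (m · g)` (★ `nElem_conj_eq`), the right factor moves into the vector (★ D-A `swSectionTensorLoc_mul_right`), then ★ (M2a-C2a).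
Consumers: [A3] `K2LiuRankOneStageIntegralsAtHalf` (LH4-p07 (g12); its `hword` binder is this conclusion: `γ g := c` constant, `Ψ g := op(j̃)(frameOp⁻¹(ω(s′((m·g)⊗1))Φ))`
sliced at `x₁ ⊔ 0`), [A4]+(σ-C) (K2Liu-p25 (g3)); the K1a instantiation takes `w₁ := ` any flip (★ `exists_flip_single`), `m := w₁⁻¹ · φ(weylTwo)` ([A1-mat] §3 corollary
`adapt_matA_flip_inv_mul_frameConj_weylTwo` ⇒ `blkC = 0`), `n(t_y) := φ(uLongTwo (yδ))` ([A1-mat] §1).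
HONEST LABEL.  Count-neutral helper: `HC_CM` is proved only modulo the 7 printed citations (2 remaining named inputs: hLiu418 = `stmt-HodgeConjecture-24832`,
h413 = `stmt-HodgeConjecture-24833`) until rung 0 closes; `hWfun`∕`hseam` stay BY VALUE (R2) per M-160f until [A1]–[A4] + (σ-C) land.

## References
* [Kudla1994] S. S. Kudla, Israel J. Math. 87 (1994), §3 Thm. 3.1.   * [Rangarao1993] R. Ranga Rao, Pacific J. Math. 157 (1993), Lemma 3.2 (3.8).
* [MoeglinVignerasWaldspurger1987] C. Mœglin, M.-F. Vignéras, J.-L. Waldspurger, LNM 1291 (1987), Chap. 2 II.1 Rem. (3), (6), II.6.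
* [HarrisKudlaSweet1996] M. Harris, S. Kudla, W. J. Sweet, J. Amer. Math. Soc. 9 (1996), §1 (1.11)–(1.12), (1.15).   * [KudlaRallis1994] S. Kudla, S. Rallis, Ann. of Math. 140 (1994), §2.
-/

set_option autoImplicit false
-- the mandated namespace repeats the single-problem summit's segment (`HodgeConjecture.HodgeConjecture`)
set_option linter.dupNamespace false

noncomputable section

open scoped Matrix Kronecker
open NumberField IsDedekindDomain MeasureTheory Matrix
open Literature.RepresentationTheory.HeisenbergGroup Literature.RepresentationTheory.HeisenbergGroup.SymplecticMatrix
open Literature.NumberTheory.Automorphic Literature.NumberTheory.Automorphic.UnitaryGroup Literature.NumberTheory.Weil1964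
open Literature.NumberTheory.GaloisRepresentations Literature.NumberTheory.GaloisRepresentations.IsNonarchimedeanLocalField
open Literature.RepresentationTheory.HarrisKudlaSweet1996
open Literature.NumberTheory.GelbartRogawski1991 Literature.NumberTheory.GelbartRogawski1991.GRConstruction
open Literature.NumberTheory.GelbartRogawski1991.AdaptedBlocks
open Literature.NumberTheory.GelbartRogawski1991.UnitaryDualPair
open Literature.NumberTheory.GelbartRogawski1991.UnitaryDualPair.LocalSplitting
open Literature.NumberTheory.GelbartRogawski1991.UnitaryDualPair.LocalSplitting.FrameTransport
open Literature.NumberTheory.GelbartRogawski1991.UnitaryDualPair.LocalSplitting.DoubledBlock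
open Literature.NumberTheory.K2Lit.SiegelDoubled
open Summit.HodgeConjecture.HodgeConjecture.Cruxes.HLiu418.K2LiuLocalSWSectionDefs
open Summit.HodgeConjecture.HodgeConjecture.Cruxes.HLiu418.K2LiuLocalSWTensorBlockTransport
open Summit.HodgeConjecture.HodgeConjecture.Cruxes.HLiu418.K2LiuLocalSWTensorBlockFrame
open Summit.HodgeConjecture.HodgeConjecture.Cruxes.HLiu418.K2LiuLocalSWTensorBigCellLetters
open Summit.HodgeConjecture.HodgeConjecture.Cruxes.HLiu418.K2LiuLocalSWTensorMiddleCellTransport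
open Summit.HodgeConjecture.HodgeConjecture.Cruxes.HLiu418.K2LiuBlockMiddleCellHaarDelta
open Summit.HodgeConjecture.HodgeConjecture.Cruxes.HLiu418.K2LiuTensorMiddleCellHaarDelta (exists_ne_zero_swSectionTensorLoc_flip_mul_nElem_eq_integral)
open Summit.HodgeConjecture.HodgeConjecture.Cruxes.HLiu418.K2LiuBadPlaceWhittakerShells (nElem_conj_eq)

namespace Summit.HodgeConjecture.HodgeConjecture.Cruxes.HLiu418.K2LiuLocalSWCornerActionWords

variable (L : Type) [Field L] [NumberField L] [IsCMField L]
variable {N M : ℕ} (e : Fin N × Fin M ≃ Fin 2)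
  (dV : Fin N → L) (hdV : ∀ i, IsCMField.complexConj L (dV i) = dV i)
  (dW : Fin M → L) (hdW : ∀ i, IsCMField.complexConj L (dW i) = dW i)
variable {M₂ M' : ℕ} (eW : Fin M × Fin M₂ ≃ Fin M') (e' : Fin N × Fin M' ≃ Fin (M₂ + M₂))
  (dV' : Fin M₂ → L) (hdV' : ∀ k, IsCMField.complexConj L (dV' k) = dV' k)
  (v : HeightOneSpectrum (𝓞 (Fp L)))
  [MeasurableSpace (v.adicCompletion (Fp L))] [BorelSpace (v.adicCompletion (Fp L))]
  (μ : Measure (v.adicCompletion (Fp L))) [μ.IsAddHaarMeasure]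
  (χ : HeckeCharacter L) (hχ : IsSplittingChar L 1 χ)

set_option maxHeartbeats 4000000 in -- ★ (M2a-C2a) needs 800000 (measured there); here the section vector carries the datum a second time (measured: 1600000 RED)
/-- **[A1] THE y-STAGE CORNER WORD: FLIP · SIEGEL ELEMENT · SIEGEL UNIPOTENT · ANYTHING.**  With ★ (M2a-C2a)'s data VERBATIM and a Siegel element `m ∈ P_Δ(L⁺_v)`
of the small doubled group `U(𝕍^𝔻)(L⁺_v)` (`blkC (matA m) = 0`), there is ONE `c ≠ 0` with, for every skew `t`, every block-side skew `t′` that reads the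
`m`-conjugate `A t D⁻¹` through the permutation frame (`hPX`), every `g` and every `Φ`:
`F_Φ(w₁ · m · n(t) · g) = c · ∫_{X₁} (unipOpPi c_{t′} (op(j̃(p₁,p₂)) (frameOp_{PD}⁻¹ (ω(s′(tensorEmbLoc (m · g))) Φ))))(x₁ ⊔ 0) dμ^{⊗(M₂+M₂)}` —
`n(A t D⁻¹) = m · n(t) · m⁻¹` (★ `nElem_conj_eq`), the right factor `m · g` moves into the vector (★ `swSectionTensorLoc_mul_right`), then ★ (M2a-C2a) at `A t D⁻¹`.
[cite: Kudla1994, §3 Thm. 3.1] [cite: HarrisKudlaSweet1996, §1 (1.11)–(1.12), (1.15)] [cite: MoeglinVignerasWaldspurger1987, Chap. 2 II.1 Rem. (3), (6), II.6]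
[cite: Rangarao1993, Lemma 3.2 (3.8), p. 351] -/
theorem exists_ne_zero_swSectionTensorLoc_flip_siegel_nElem_mul_eq_integral (hM₂ : 0 < M₂ + M₂)
    (hT₀d : IsUnit (gramR L e' dV hdV (tensorFrame L dW eW dV') (tensorFrame_real L dW hdW eW dV' hdV')).det)
    {i₀ i₁ : Fin 2} (hi : i₀ ≠ i₁) {σ : Equiv.Perm (Fin (M₂ + M₂))}
    (hσ₀ : ∀ k, σ (epsV e eW e' (i₀, k)) = finSumFinEquiv (Sum.inl k)) (hσ₁ : ∀ k, σ (epsV e eW e' (i₁, k)) = finSumFinEquiv (Sum.inr k))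
    {T₁ T₂ : Matrix (Fin M₂) (Fin M₂) (Fp L)}
    (P : GL (Fin (M₂ + M₂)) (Fp L)) (hPσ : (P : Matrix (Fin (M₂ + M₂)) (Fin (M₂ + M₂)) (Fp L)) = σ.toPEquiv.toMatrix)
    (hP : ((P : Matrix (Fin (M₂ + M₂)) (Fin (M₂ + M₂)) (Fp L)))ᵀ *
        gramR L e' dV hdV (tensorFrame L dW eW dV') (tensorFrame_real L dW hdW eW dV' hdV') * (P : Matrix _ _ (Fp L)) =
      UnitaryGroup.finSum M₂ M₂ T₁ T₂)
    (t' : Fin (M₂ + M₂) → Fp L) (hT' : UnitaryGroup.finSum M₂ M₂ T₁ T₂ = Matrix.diagonal t') (hT₀'d : IsUnit (UnitaryGroup.finSum M₂ M₂ T₁ T₂).det)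
    {PD : GL (Fin ((M₂ + M₂) + (M₂ + M₂))) (Fp L)} (hPD : PD = UnitaryGroup.reindexGL (e₂ (M₂ + M₂)) (UnitaryGroup.blockDiagGL (P, P)))
    (m₀ : LocalMp (Fp L) ((M₂ + M₂) + (M₂ + M₂))
      (gramD (Fp L) (M₂ + M₂) (gramR L e' dV hdV (tensorFrame L dW eW dV') (tensorFrame_real L dW hdW eW dV' hdV'))) v)
    (hm₀ : (deltaLagrangian (Fp L) v (M₂ + M₂)).map (toLin (Fp L) v (MpPsi.proj _ m₀)) = lagrangianY (Fp L) ((M₂ + M₂) + (M₂ + M₂)) v)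
    {w₁ : UnitaryGroup.localPi L (IsCMField.complexConj L) (2 + 2) (hermD L e dV hdV dW hdW) v}
    (hw₁ : adapt (matA (Fp L) L (IsCMField.complexConj L) v 2 w₁) =
      Matrix.fromBlocks (1 - Matrix.single i₀ i₀ 1) (Matrix.single i₀ i₀ 1) (Matrix.single i₀ i₀ 1) (1 - Matrix.single i₀ i₀ 1))
    -- the block data of (M2a-C1)
    (hM₂' : 0 < M₂) (t₁ : Fin M₂ → Fp L) (hT₁t : T₁ = Matrix.diagonal t₁) (hT₁ : T₁.IsSymm) (hT₂ : T₂.IsSymm)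
    (hT₁d : IsUnit T₁.det) (hT₂d : IsUnit T₂.det)
    (hTv₁ : IsUnit (localGram (Fp L) (M₂ + M₂) (gramD (Fp L) M₂ T₁) v).det)
    (p₁ : LocalMp (Fp L) (M₂ + M₂) (gramD (Fp L) M₂ T₁) v)
    (hp₁ : (deltaLagrangian (Fp L) v M₂).map (toLin (Fp L) v (MpPsi.proj _ p₁)) = lagrangianY (Fp L) (M₂ + M₂) v)
    (B₁ : GL (Fin (M₂ + M₂)) (v.adicCompletion (Fp L)))
    (hW₁ : MpPsi.proj _ p₁ * iotaD (Fp L) L (IsCMField.complexConj L) (complexConj_imagUnit L) (imagUnit_ne_zero L)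
        (imagUnit_mul_self L) v M₂ hT₁ rfl (weylDelta (Fp L) L (IsCMField.complexConj L) v M₂ (T₀ := T₁) rfl) * (MpPsi.proj _ p₁)⁻¹ =
      (transportSp (localGram (Fp L) (M₂ + M₂) (gramD (Fp L) M₂ T₁) v) hTv₁ (SymplecticGroup.symJ _ _))⁻¹ *
        transportSp (localGram (Fp L) (M₂ + M₂) (gramD (Fp L) M₂ T₁) v) hTv₁ (levi B₁))
    {m : ℤ} (hm : (adeleAddCharAt (Fp L) v).HasConductorExp m)
    (p₂ : LocalMp (Fp L) (M₂ + M₂) (gramD (Fp L) M₂ T₂) v)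
    (hp₂ : (deltaLagrangian (Fp L) v M₂).map (toLin (Fp L) v (MpPsi.proj _ p₂)) = lagrangianY (Fp L) (M₂ + M₂) v)
    -- the Siegel element between the flip and the unipotent ([A1-mat] §3: `m := w₁⁻¹ · φ(weylTwo)`)
    {m : UnitaryGroup.localPi L (IsCMField.complexConj L) (2 + 2) (hermD L e dV hdV dW hdW) v}
    (hmC : blkC (matA (Fp L) L (IsCMField.complexConj L) v 2 m) = 0) :
    ∃ c : ℂ, c ≠ 0 ∧ ∀ (t : Matrix (Fin 2) (Fin 2) (LocalRing L v))
      (ht : (t.map (conjLocal L (IsCMField.complexConj L) v))ᵀ * gramS (Fp L) L v 2 (gramR L e dV hdV dW hdW) + gramS (Fp L) L v 2 (gramR L e dV hdV dW hdW) * t = 0)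
      (hAtD : (((blkA (matA (Fp L) L (IsCMField.complexConj L) v 2 m) * t * (blkD (matA (Fp L) L (IsCMField.complexConj L) v 2 m))⁻¹)).map (conjLocal L (IsCMField.complexConj L) v))ᵀ * gramS (Fp L) L v 2 (gramR L e dV hdV dW hdW) +
        gramS (Fp L) L v 2 (gramR L e dV hdV dW hdW) * (blkA (matA (Fp L) L (IsCMField.complexConj L) v 2 m) * t * (blkD (matA (Fp L) L (IsCMField.complexConj L) v 2 m))⁻¹) = 0)
      (tb : Matrix (Fin (M₂ + M₂)) (Fin (M₂ + M₂)) (LocalRing L v))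
      (htb : (tb.map (conjLocal L (IsCMField.complexConj L) v))ᵀ * gramS (Fp L) L v (M₂ + M₂) (UnitaryGroup.finSum M₂ M₂ T₁ T₂) +
        gramS (Fp L) L v (M₂ + M₂) (UnitaryGroup.finSum M₂ M₂ T₁ T₂) * tb = 0)
      (_hPX : (P : Matrix (Fin (M₂ + M₂)) (Fin (M₂ + M₂)) (Fp L)).map ((UnitaryGroup.toLocalRing L v).comp (algebraMap (Fp L) (v.adicCompletion (Fp L)))) * tb *
        ((P⁻¹ : GL (Fin (M₂ + M₂)) (Fp L)) : Matrix (Fin (M₂ + M₂)) (Fin (M₂ + M₂)) (Fp L)).map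
          ((UnitaryGroup.toLocalRing L v).comp (algebraMap (Fp L) (v.adicCompletion (Fp L)))) =
        Matrix.reindex (epsV e eW e') (epsV e eW e') ((blkA (matA (Fp L) L (IsCMField.complexConj L) v 2 m) * t * (blkD (matA (Fp L) L (IsCMField.complexConj L) v 2 m))⁻¹) ⊗ₖ (1 : Matrix (Fin M₂) (Fin M₂) (LocalRing L v))))
      (g : UnitaryGroup.localPi L (IsCMField.complexConj L) (2 + 2) (hermD L e dV hdV dW hdW) v)
      (Φ : SchwartzBruhat (Fin ((M₂ + M₂) + (M₂ + M₂)) → v.adicCompletion (Fp L))),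
      swSectionTensorLoc L e dV hdV dW hdW eW e' dV' hdV' v
          (localSplittingDatumCM L v μ (M₂ + M₂)
            (gramR_isSymm L e' dV hdV (tensorFrame L dW eW dV') (tensorFrame_real L dW hdW eW dV' hdV')) hT₀d
            (hermD_eq_map_gramD L e' dV hdV (tensorFrame L dW eW dV') (tensorFrame_real L dW hdW eW dV' hdV')) χ hχ).localSplitting
          m₀ Φ
          (w₁ * m * nElem (Fp L) L (IsCMField.complexConj L) v 2 (T₀ := gramR L e dV hdV dW hdW) (hermD_eq_map_gramD L e dV hdV dW hdW) t ht * g) =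
        c * ∫ x₁ : Fin (M₂ + M₂) → v.adicCompletion (Fp L),
          ((unipOpPi (isLocallyConstant_of_isContinuousNontrivial (isContinuousNontrivial_adeleAddCharAt (Fp L) v))
            (Matrix.mulVecLin (cOfFix (localGram (Fp L) ((M₂ + M₂) + (M₂ + M₂)) (gramD (Fp L) (M₂ + M₂) (UnitaryGroup.finSum M₂ M₂ T₁ T₂)) v)
              (MpPsi.proj _ (boxLoc (Fp L) v M₂ M₂ (T₁ := T₁) (T₂ := T₂) (p₁, p₂)) *
                iotaD (Fp L) L (IsCMField.complexConj L) (complexConj_imagUnit L) (imagUnit_ne_zero L) (imagUnit_mul_self L) v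
                  (M₂ + M₂) (UnitaryGroup.isSymm_finSum hT₁ hT₂) rfl
                  (nElem (Fp L) L (IsCMField.complexConj L) v (M₂ + M₂) (T₀ := UnitaryGroup.finSum M₂ M₂ T₁ T₂) rfl tb htb) *
                (MpPsi.proj _ (boxLoc (Fp L) v M₂ M₂ (T₁ := T₁) (T₂ := T₂) (p₁, p₂)))⁻¹)))
            (MpPsi.toOp _ (boxLoc (Fp L) v M₂ M₂ (T₁ := T₁) (T₂ := T₂) (p₁, p₂))
              ((frameOp (Fp L) v ((M₂ + M₂) + (M₂ + M₂)) PD).symm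
                (MpPsi.toRep (localSchrodinger (Fp L) ((M₂ + M₂) + (M₂ + M₂))
                  (gramD (Fp L) (M₂ + M₂) (gramR L e' dV hdV (tensorFrame L dW eW dV') (tensorFrame_real L dW hdW eW dV' hdV'))) v)
                ((localSplittingDatumCM L v μ (M₂ + M₂)
                  (gramR_isSymm L e' dV hdV (tensorFrame L dW eW dV') (tensorFrame_real L dW hdW eW dV' hdV')) hT₀d
                  (hermD_eq_map_gramD L e' dV hdV (tensorFrame L dW eW dV') (tensorFrame_real L dW hdW eW dV' hdV')) χ hχ).localSplitting
                  (tensorEmbLoc L e dV hdV dW hdW eW e' dV' hdV' v (m * g))) Φ))) :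
              SchwartzBruhat (Fin ((M₂ + M₂) + (M₂ + M₂)) → v.adicCompletion (Fp L))) :
            (Fin ((M₂ + M₂) + (M₂ + M₂)) → v.adicCompletion (Fp L)) → ℂ)
            (glue (blkIdx M₂ M₂) x₁ (0 : Fin (M₂ + M₂) → v.adicCompletion (Fp L))) ∂(Measure.pi fun _ => μ) := by
  obtain ⟨c, hc, h⟩ := exists_ne_zero_swSectionTensorLoc_flip_mul_nElem_eq_integral L e dV hdV dW hdW eW e' dV' hdV' v μ χ hχ hM₂ hT₀d hi hσ₀ hσ₁
    P hPσ hP t' hT' hT₀'d hPD m₀ hm₀ hw₁ hM₂' t₁ hT₁t hT₁ hT₂ hT₁d hT₂d hTv₁ p₁ hp₁ B₁ hW₁ hm p₂ hp₂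
  refine ⟨c, hc, fun t ht hAtD tb htb hPX g Φ => ?_⟩
  -- `w₁ · m · n(t) · g = (w₁ · n(A t D⁻¹)) · (m · g)`
  have hconj := nElem_conj_eq (Fp L) L (IsCMField.complexConj L) v 2 (hermD_eq_map_gramD L e dV hdV dW hdW) hmC ht hAtD
  have hsplit : w₁ * m * nElem (Fp L) L (IsCMField.complexConj L) v 2 (T₀ := gramR L e dV hdV dW hdW) (hermD_eq_map_gramD L e dV hdV dW hdW) t ht * g =
      w₁ * nElem (Fp L) L (IsCMField.complexConj L) v 2 (T₀ := gramR L e dV hdV dW hdW) (hermD_eq_map_gramD L e dV hdV dW hdW)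
        (blkA (matA (Fp L) L (IsCMField.complexConj L) v 2 m) * t * (blkD (matA (Fp L) L (IsCMField.complexConj L) v 2 m))⁻¹) hAtD * (m * g) := by
    rw [hconj]
    simp only [mul_assoc, inv_mul_cancel_left]
  rw [hsplit, swSectionTensorLoc_mul_right]
  exact h _ hAtD tb htb hPX _

end Summit.HodgeConjecture.HodgeConjecture.Cruxes.HLiu418.K2LiuLocalSWCornerActionWords

end
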